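import Summits.Ventures.Crystal3D.Theorems.StickyWulffConstantGenericWallFloorGrainCredits
import HarnessLib

/-!
# The source count of the general-filling ledger: at least a flux of exits above the clamped slab

HONEST FRAMING. Part of the venture `Summits/Ventures/Crystal3D` (cell `crystal3d-full`), helper for the
crux `GenericWallFloor` (stmt-Ventures-19480) of `route-Ventures-StickyWulffConstant`, REGISTERED line
`WallLedgerG` (planner cf-p1 gen 16), stub `stub_twoSlabAdhesion : TwoSlabAdhesion` (THE CRUX of the line).
Brick of the general-filling architecture «monotone Barlow lines» (memo GENERAL-FILLING-ARCH on the item):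
the SOURCES.  Rung credit only; F-C1 not moved.

An EXIT of the grain `Λ = A·Λ₀ + t` in a configuration `X` (along the slot `u`) is a ball `e ∈ X` whose
predecessor `e − A u ∈ X` carries its FULL shell (`e − A u + A w ∈ X` for all twelve slots `w`) while `e`
itself lacks a slot (`e + A v ∉ X` for some slot `v`) — the hypothesis shape of the exit lemma
`exit_trichotomy` (`…ExitTrichotomy`): an exit pays within contact distance three or is an exact twin cap.

**Theorem (`card_exits_ge`).**  In the cell of `TwoSlabAdhesion` (clamped sample `P ⊆ X` complete in
`[−2R₀, −R₀] × disc ρ`, `3 ≤ R₀ ≤ ρ`; NO hypothesis on the filling, no `1`-separation needed) the exits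
along any slot `u` number at least `√2 |⟪A u, e₃⟫| π (ρ − 1)² − 10 √2 π (ρ − 1)` — the full line flux
of the slot class through the disc (for the steep class `√2 ⟪A u, e₃⟫ ≥ 1`).  Mechanism: the inner sample
`P'` (window `[−2R₀ + 1, −R₀ − 1]`, radius `ρ − 1`) consists of full-shell balls (`inner_sample_full`);
it is run-convex, so its `u`-line tops inject into the tops of maximal FULL-SHELL runs leaving it
(`card_runTops_le_structured` applied to the full-shell sub-configuration `D`), whose successors are
pairwise distinct exits; and `tops_ge_lineCount` counts the line tops of `P'`.

WHAT THIS IS NOT: not the stub (exits still have to be paid — `exit_trichotomy` — and followed through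
twin caps); F-C1 not moved.
-/

noncomputable section

namespace Summit.Ventures.Crystal3D.Theorems

open Summit.Ventures.Crystal3D Finset
open Literature.MathematicalPhysics.StatisticalMechanics (fccStacking)
open scoped InnerProductSpace

/-- **The inner sample has full shells.**  If the sample `P` is complete in `[−2R₀, −R₀] × disc ρ`
(`1 ≤ ρ`), a grain ball `p` with `−2R₀ + 1 ≤ p₂ ≤ −R₀ − 1` and lateral radius² `≤ (ρ − 1)²` has all
twelve slots `p + A w` in `P`. -/
theorem inner_sample_full
    (A : EuclideanSpace ℝ (Fin 3) ≃ₗᵢ[ℝ] EuclideanSpace ℝ (Fin 3)) (t : EuclideanSpace ℝ (Fin 3))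
    (P : Finset (EuclideanSpace ℝ (Fin 3))) (R₀ ρ : ℝ) (hρ : 1 ≤ ρ)
    (hP : ∀ p, p ∈ P ↔ (p ∈ (fun q => A q + t) '' fccStacking 1 (Real.sqrt (2 / 3)) ∧
      -(2 * R₀) ≤ p 2 ∧ p 2 ≤ -R₀ ∧ p 0 ^ 2 + p 1 ^ 2 ≤ ρ ^ 2))
    {p : EuclideanSpace ℝ (Fin 3)} (hpΛ : p ∈ (fun q => A q + t) '' fccStacking 1 (Real.sqrt (2 / 3)))
    (hp1 : -(2 * R₀) + 1 ≤ p 2) (hp2 : p 2 ≤ -R₀ - 1) (hp3 : p 0 ^ 2 + p 1 ^ 2 ≤ (ρ - 1) ^ 2)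
    {w : EuclideanSpace ℝ (Fin 3)} (hw : w ∈ fccSlots) : p + A w ∈ P := by
  have hw1 : ‖A w‖ = 1 := by rw [LinearIsometryEquiv.norm_map, norm_eq_one_of_mem_fccSlots hw]
  have hα := abs_inner_slot_le_one A hw
  have h2 : (p + A w) 2 = p 2 + ⟪A w, EuclideanSpace.single (2 : Fin 3) (1 : ℝ)⟫_ℝ := by
    rw [PiLp.add_apply, apply_two_eq_inner_e₃ (A w)]
  obtain ⟨hαl, hαu⟩ := abs_le.1 hα
  rw [hP]
  refine ⟨movedFcc_add_site_mem A t hpΛ (mem_fcc_of_mem_fccSlots hw), by rw [h2]; linarith,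
    by rw [h2]; linarith, ?_⟩
  -- lateral radius
  have hρ1 : (0 : ℝ) ≤ ρ - 1 := by linarith
  have hsp : Real.sqrt (p 0 ^ 2 + p 1 ^ 2) ≤ ρ - 1 := by
    rw [← Real.sqrt_sq hρ1]; exact Real.sqrt_le_sqrt hp3
  have h1 := sqrt_lateral_add_le p (A w)
  rw [hw1] at h1
  have h3 : Real.sqrt ((p + A w) 0 ^ 2 + (p + A w) 1 ^ 2) ≤ ρ := by linarith
  have h4 := Real.sq_sqrt (by positivity : (0 : ℝ) ≤ (p + A w) 0 ^ 2 + (p + A w) 1 ^ 2)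
  have h5 : (0 : ℝ) ≤ Real.sqrt ((p + A w) 0 ^ 2 + (p + A w) 1 ^ 2) := Real.sqrt_nonneg _
  nlinarith

open scoped Classical in
/-- **Exits are at least a flux.**  See the module docstring. -/
theorem card_exits_ge
    (A : EuclideanSpace ℝ (Fin 3) ≃ₗᵢ[ℝ] EuclideanSpace ℝ (Fin 3)) (t : EuclideanSpace ℝ (Fin 3))
    (X P : Finset (EuclideanSpace ℝ (Fin 3))) (R₀ ρ : ℝ) (hR₀ : 3 ≤ R₀) (hρ : R₀ ≤ ρ) (hPX : P ⊆ X)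
    (hP : ∀ p, p ∈ P ↔ (p ∈ (fun q => A q + t) '' fccStacking 1 (Real.sqrt (2 / 3)) ∧
      -(2 * R₀) ≤ p 2 ∧ p 2 ≤ -R₀ ∧ p 0 ^ 2 + p 1 ^ 2 ≤ ρ ^ 2))
    {u : EuclideanSpace ℝ (Fin 3)} (hu : u ∈ fccSlots) :
    Real.sqrt 2 * |⟪A u, EuclideanSpace.single (2 : Fin 3) (1 : ℝ)⟫_ℝ| * Real.pi * (ρ - 1) ^ 2 -
        10 * Real.sqrt 2 * Real.pi * (ρ - 1) ≤
      (((X.filter fun e => e - A u ∈ X ∧ (∀ w ∈ fccSlots, e - A u + A w ∈ X) ∧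
          ∃ v ∈ fccSlots, e + A v ∉ X).card : ℕ) : ℝ) := by
  have hρ1 : (1 : ℝ) ≤ ρ := by linarith
  -- the full-shell sub-configuration and the inner sample
  obtain ⟨D, hD⟩ : ∃ D : Finset (EuclideanSpace ℝ (Fin 3)),
      D = X.filter (fun q => ∀ w ∈ fccSlots, q + A w ∈ X) := ⟨_, rfl⟩
  obtain ⟨P', hP'def⟩ : ∃ P' : Finset (EuclideanSpace ℝ (Fin 3)), P' = P.filter (fun p =>
      -(2 * R₀) + 1 ≤ p 2 ∧ p 2 ≤ -R₀ - 1 ∧ p 0 ^ 2 + p 1 ^ 2 ≤ (ρ - 1) ^ 2) := ⟨_, rfl⟩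
  have hP' : ∀ p, p ∈ P' ↔ (p ∈ (fun q => A q + t) '' fccStacking 1 (Real.sqrt (2 / 3)) ∧
      (-(2 * R₀) + 1) ≤ p 2 ∧ p 2 ≤ (-(2 * R₀) + 1) + (R₀ - 2) ∧ p 0 ^ 2 + p 1 ^ 2 ≤ (ρ - 1) ^ 2) := by
    intro p
    rw [hP'def, mem_filter, hP]
    constructor
    · rintro ⟨⟨hΛ, -, -, -⟩, h1, h2, h3⟩
      exact ⟨hΛ, h1, by linarith, h3⟩
    · rintro ⟨hΛ, h1, h2, h3⟩
      have hρ0 : (0 : ℝ) ≤ ρ - 1 := by linarith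
      refine ⟨⟨hΛ, by linarith, by linarith, ?_⟩, h1, by linarith, h3⟩
      nlinarith
  have hP'D : P' ⊆ D := by
    intro p hp
    obtain ⟨hΛ, h1, h2, h3⟩ := (hP' p).1 hp
    rw [hD, mem_filter]
    refine ⟨hPX ((hP _).2 ?_), fun w hw => hPX (inner_sample_full A t P R₀ ρ hρ1 hP hΛ h1 (by linarith) h3 hw)⟩
    have hρ0 : (0 : ℝ) ≤ ρ - 1 := by linarith
    exact ⟨hΛ, by linarith, by linarith, by nlinarith⟩
  -- line tops of the inner sample
  obtain ⟨Ea, Eb, hEa, hEb, hdet, hframe, -⟩ := exists_frame_of_mem_fccSlots hu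
  have h1 := tops_ge_lineCount A t (-(2 * R₀) + 1) (R₀ - 2) (ρ - 1) (by linarith) (by linarith) P' hP'
    Ea Eb u hEa hEb (norm_eq_one_of_mem_fccSlots hu) hdet hframe
  -- tops of maximal full-shell runs from the inner sample
  have hu0 : A u ≠ 0 := by
    intro h0
    have : ‖A u‖ = 0 := by rw [h0, norm_zero]
    rw [LinearIsometryEquiv.norm_map, norm_eq_one_of_mem_fccSlots hu] at this
    norm_num at this
  have hP'eq : ∀ p, p ∈ P' ↔ (p ∈ (fun q => A q + t) '' fccStacking 1 (Real.sqrt (2 / 3)) ∧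
      (-(2 * R₀) + 1) ≤ p 2 ∧ p 2 ≤ -R₀ - 1 ∧ p 0 ^ 2 + p 1 ^ 2 ≤ (ρ - 1) ^ 2) := by
    intro p; rw [hP' p, show -(2 * R₀) + 1 + (R₀ - 2) = -R₀ - 1 by ring]
  have h2 := card_runTops_le_structured D P' (A u) hu0 hP'D
    (runConvex_clampedSample A t (-(2 * R₀) + 1) (-R₀ - 1) (ρ - 1) (by linarith) P' hP'eq
      (mem_fcc_of_mem_fccSlots hu))
  -- (re-state with this file's decidability instances)
  have h2' : (P'.filter fun p => p + A u ∉ P').card ≤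
      (D.filter fun q => q + A u ∉ D ∧ (q ∈ P' ∨ q - A u ∈ D)).card := by
    convert h2 using 3
  -- successors of these tops are distinct exits
  have h3 : (D.filter fun q => q + A u ∉ D ∧ (q ∈ P' ∨ q - A u ∈ D)).card ≤
      (X.filter fun e => e - A u ∈ X ∧ (∀ w ∈ fccSlots, e - A u + A w ∈ X) ∧
        ∃ v ∈ fccSlots, e + A v ∉ X).card := by
    refine Finset.card_le_card_of_injOn (fun q => q + A u) ?_ ?_
    · intro q hq
      rw [Finset.mem_coe, mem_filter] at hq
      obtain ⟨hqD, hnot, -⟩ := hq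
      rw [hD, mem_filter] at hqD
      obtain ⟨hqX, hfull⟩ := hqD
      have heX : q + A u ∈ X := hfull u hu
      rw [Finset.mem_coe, mem_filter]
      refine ⟨heX, by rw [add_sub_cancel_right]; exact hqX,
        fun w hw => by rw [add_sub_cancel_right]; exact hfull w hw, ?_⟩
      by_contra hall
      push Not at hall
      apply hnot
      rw [hD, mem_filter]
      exact ⟨heX, hall⟩
    · intro q _ q' _ h
      exact add_right_cancel h
  have h1' : Real.sqrt 2 * |⟪A u, EuclideanSpace.single (2 : Fin 3) (1 : ℝ)⟫_ℝ| * Real.pi * (ρ - 1) ^ 2 -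
      10 * Real.sqrt 2 * Real.pi * (ρ - 1) ≤ (((P'.filter fun p => p + A u ∉ P').card : ℕ) : ℝ) := by
    convert h1 using 3
  have hcast : (((P'.filter fun p => p + A u ∉ P').card : ℕ) : ℝ) ≤
      (((X.filter fun e => e - A u ∈ X ∧ (∀ w ∈ fccSlots, e - A u + A w ∈ X) ∧
        ∃ v ∈ fccSlots, e + A v ∉ X).card : ℕ) : ℝ) := by
    exact_mod_cast h2'.trans h3
  exact h1'.trans hcast

end Summit.Ventures.Crystal3D.Theorems

end
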